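import Literature.Probability.RandomPlanarGeometry.HexSAWSurfaceSqrtAsymptotic
import Literature.Probability.RandomPlanarGeometry.HexSAWSurfaceSqrtStrict
import Literature.Probability.RandomPlanarGeometry.HexSAWSurfaceHookRenewal
import Literature.Probability.RandomPlanarGeometry.HexSAWArmchairSqrtAsymptotic
import HarnessLib

/-!
# Honeycomb SAW at the Duminil-Copin–Smirnov surface (brick-wall frame): the second-order coefficient of the adsorbed-phase free energy
# is EXACTLY ONE — `β(y)² = y + 1/y + O(y⁻²)`, i.e. `y · (β(y)² − y) → 1`, `y^{3/2} (β(y) − √y) → ½`, `y² (log β(y) − ½ log y) → ½`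

Topic `Literature/Probability/RandomPlanarGeometry` (lane «pcv-sawmu», car «WALL-SECOND-ORDER-SHARP», a-p6 g15).  Continues
`HexSAWSurfaceSqrtAsymptotic.lean` («WALL-SQRT-ASYMPTOTIC»: the last-surface-visit fibres `Wall.fibW m k` of the arches `archs (m+4)`,
`fibW_anatomy`, `sum_fibW_self_le`, `sum_fibW_le`, `Aw_le_rec`, the Fekete transfer `wallRate_le_of_WB_le`, `β(y)/√y → 1`),
`HexSAWSurfaceSqrtStrict.lean` (the explicit dip `Six.dw`), `HexSAWSurfaceHookRenewal.lean` (a-idea-1 car 27: the renewal LOWER window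
`sq_wallRate_ge_sub : β² ≤ y + C/y → y + h/y − 3hC/y³ ≤ β²` with `h = hookConst = wbrN 6 1`, `1 ≤ h` by hypothesis, value not of record)
and `HexSAWArmchairSqrtAsymptotic.lean` (public counting lemmas `Arm.card_saws_le_three_pow`, `Arm.sum_pow_mul_three_pow_le`, `Arm.eq_of_agree`).

Sources.  N. R. Beaton, M. Bousquet-Mélou, J. de Gier, H. Duminil-Copin, A. J. Guttmann, *The critical fugacity for surface adsorption of
self-avoiding walks on the honeycomb lattice is `1 + √2`*, CMP 326 (2014) = arXiv:1109.0358v5, §3.1, Proposition 5 (p. 9) and p. 10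
("This translates into `μ(y) ∼ √y` in our honeycomb setting", after G. Rychlewski, S. G. Whittington, J. Stat. Phys. 145 (2011) 661–668,
`μ(y) ∼ y` on the square lattice — [23] there, not held).  E. J. Janse van Rensburg, *The Statistical Mechanics of Interacting Walks,
Polygons, Animals and Vesicles* (OUP 2000), §3.3.2, Lemma 3.20 (excursions; density functions).  J. M. Hammersley, G. M. Torrie,
S. G. Whittington, J. Phys. A 15 (1982) 539, §2 (unfolded surface walks; locator provisional, source not held).  I. G. Enting, I. Jensen,
LNP 775 (2009), §7.4.2, Fig. 7.10 (brickwork form).  N. Madras, G. Slade, *The Self-Avoiding Walk* (1993), §1.2 ((1.2.3), Lemma 1.2.2).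

## The object and the state of the lane before this file

`β(y) = Wall.wallRate y` is the DCS-frame wall-bridge rate of `HexSAWSurfaceWallBridges.lean` (`= μ(y)` of BBdGDCG Prop. 5 for every `y > 0`,
`HexSAWSurfaceWallRateEq.lean`).  In the tree: `β(y)/√y → 1` with an `O(y^{-1/2})` window (`HexSAWSurfaceSqrtAsymptotic`); the ORDER of the
correction, `β(y)² − y ≍ 1/y` (`HexSAWSurfaceWallPotential`, a-p5: `y + 1/(5y) ≤ β² ≤ y + 6/y`, `y ≥ 25`); and the renewal LOWER
coefficient `liminf y (β² − y) ≥ h` (`HexSAWSurfaceHookRenewal`, a-idea-1 car 27), whose author recorded the UPPER half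
`β² ≤ y + h/y + O(y⁻²)` as «the door, not attempted» (it "needs the prime-piece entropy bound").  This file proves that upper half with
the sharp constant, evaluates `h = 1`, and assembles the second-order law.

## What is proved (namespace `…SAW.HexBW.Wall`)

* §1–§2 **Extendable arches.**  `ExtRow n ω` (some row-neighbour of the endpoint is fresh), `archsX n`, `Xw n y = X_n(y)`; `WB_le_Xw`
  (every wall bridge is extendable: the site right of its rightmost end is fresh), `Xw_le_Aw`, and ★ `prefixWalk_mem_archsX`: the prefix
  of a half-plane walk cut at a NON-FINAL surface visit is an extendable arch (witness: the next vertex).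
* §3 The parent's fibre bounds re-targeted at `X`: `sum_fibre_lastV_le_X` (`≤ X_k c_{n−k}`), `sum_fibW_le_X` (`≤ 2y X_k c_{m+3−k}`),
  `sum_fibW_self_le_X` (straight fibre `≤ y X_{m+2}`).
* §4 ★★ **`dip_coords`**: an EXTENDABLE arch whose last surface visit is six steps before its end ends with the forward dip
  `(x+σ,0)(x+σ,−1)(x+2σ,−1)(x+3σ,−1)(x+3σ,0)(x+4σ,0)` — going back under the start meets `ω (j+1)`, the «hook» `(x+3σ,0) → (x+2σ,0)`
  is a dead end (both row-neighbours visited), deeper moves are too long; ★ `sum_fibW_dip_le_X : Σ_{dip fibre, extendable} ≤ y · X_{j+2}`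
  (ONE shape, injective prefix map).
* §5 `not_mem_fibW_diag` (no excursion of length four), `sum_fibW_eq_zero_of_near`, and ★★ THE RECURSION
  **`Xw_le_rec : X_{j+8} ≤ y X_{j+6} + y X_{j+2} + 2y Σ_{k ≤ j} X_k c_{j+7−k}(ℍ)`** — characteristic equation `1 = yz + yz³ + O(y z⁴)`, `z = β⁻²`.
* §6 `Xw_le_mul_pow`: `6 ≤ ρ`, `y/ρ² + y/ρ⁶ + 8748 y/ρ⁸ ≤ 1 ⇒ X_n(y) ≤ 2187 y⁷ ρⁿ` (`8748 = 4·3⁷`).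
* §7 ★★★ **`wallRate_sq_le_sharp (1 ≤ y) : β(y)² ≤ y + 1/y + 8748/y²`** (no threshold: `ρ² = y + 1/y + 8748/y² ≥ 36` always),
  `mul_wallRate_sq_sub_le : y (β² − y) ≤ 1 + 8748/y`, `wallRate_sq_le_add_div : β² ≤ y + 8749/y`.
* §8 ★★ **`wbrN_six_one : wbrN 6 1 = 1`**, `hookConst_eq_one` — the only one-visit wall bridge of length six is the forward dip
  (`one_visit_six_coords`; lengths kept symbolic so that no closed `wbr 6` is ever elaborated).
* §9 ★★★ **THE SECOND-ORDER LAW**: `sharp_lower_window : y + 1/y − 26247/y³ ≤ β(y)²`, `wallRate_sq_sub_sub_mem_Icc :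
  β(y)² − y − 1/y ∈ [−26247/y³, 8748/y²]` (every `y ≥ 1`), `abs_mul_wallRate_sq_sub_sub_one_le : |y (β² − y) − 1| ≤ 34995/y`,
  ★★★ **`tendsto_mul_wallRate_sq_sub : y (β(y)² − y) → 1`**, `isBigO_wallRate_sq_sub_sub : β² − y − 1/y = O(y⁻²)`,
  ★★ `tendsto_mul_sqrt_mul_wallRate_sub_sqrt : y √y (β(y) − √y) → ½`, ★★ `tendsto_sq_mul_log_wallRate_sub : y² (log β(y) − ½ log y) → ½`.

HONEST LABEL (author's proposal).  Print has the first-order law only, and without proof for the honeycomb surface (BBdGDCG p. 10 after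
Rychlewski–Whittington's square-lattice `μ(y) ∼ y`).  The second-order law with its EXACT coefficient — `μ(y)² = y + 1/y + O(y⁻²)` for the
BBdGDCG surface fugacity model, equivalently surface free energy `κ(y) = ½ log y + 1/(2y²) + o(y⁻²)` — is, as far as the lane's holdings and
presearch show (corpus hybrid/vector «second-order correction adsorbed phase free energy self-avoiding walk surface», galaxy needles
«adsorbed phase|large fugacity|1/y correction»: nothing beyond RW11/HTW82's first-order statements; exactly solvable DIRECTED adsorption
models do have closed-form free energies, e.g. Janse van Rensburg 2015 §4 (4.191) for adsorbing staircase walks — not this model), NEW IN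
WRITING (modest, S; elementary, ≈ 950 lines over the lane's surface-walk infrastructure).  Mechanism: the renewal/defect-gas picture (printed folklore, JvR 2000 §3.3) made
rigorous from ABOVE by counting only EXTENDABLE arches, which kills the dead-end «hook» that otherwise doubles the `1/y` coefficient.
The constants `8748`, `26247`, `34995` are not optimised.  NOT CLAIMED: the `O(y⁻²)` coefficient; anything for the armchair (rotated) wall.
-/

noncomputable section

open Finset Filter Function
open Literature.Probability.LatticeModels Literature.Probability.Percolation SimpleGraph
open _root_.Topology

namespace Literature.Probability.RandomPlanarGeometry.SAW.HexBW.Wall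

variable {y : ℝ} {n : ℕ} {ω : ℕ → Site 2}

/-! ### §1  Extendable arches -/

/-- An `n`-step walk is **extendable along the row** if some row-neighbour of its endpoint (a site `z` adjacent to `ω n` with `z₁ = 0`) has
not been visited during `[0, n]`.  Dead ends (e.g. the «hook» ending `… (x+3,−1) (x+3,0) (x+2,0)` after `(x,0) (x+1,0) (x+1,−1) …`) are
not extendable; every proper prefix of a longer arch, cut at a surface visit, is. [cite: HammersleyTorrieWhittington1982, §2 (unfolded surface walks; locator provisional, source not held); MadrasSlade1993, §1.2, (1.2.3)] -/
def ExtRow (n : ℕ) (ω : ℕ → Site 2) : Prop := ∃ z : Site 2, brickWallGraph.Adj (ω n) z ∧ z 1 = 0 ∧ ∀ i ≤ n, ω i ≠ z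

open Classical in
/-- The extendable arches of length `n`. [cite: HammersleyTorrieWhittington1982, §2 (unfolded surface walks; locator provisional)] -/
def archsX (n : ℕ) : Finset (ℕ → Site 2) := (archs n).filter (ExtRow n)

open Classical in
/-- Their surface-weighted count `X_n(y) = Σ_{extendable arches} y^{visits}`. [cite: HammersleyTorrieWhittington1982, §2 (unfolded surface walks; locator provisional)] -/
def Xw (n : ℕ) (y : ℝ) : ℝ := ∑ ω ∈ archsX n, y ^ visits n ω

open Classical in
/-- Membership. [cite: HammersleyTorrieWhittington1982, §2] -/
theorem mem_archsX : ω ∈ archsX n ↔ ω ∈ archs n ∧ ExtRow n ω := Finset.mem_filter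

open Classical in
/-- `archsX n ⊆ archs n`. [cite: HammersleyTorrieWhittington1982, §2] -/
theorem archsX_subset : archsX n ⊆ archs n := Finset.filter_subset _ _

open Classical in
/-- `X_n(y) ≥ 0`. [cite: HammersleyTorrieWhittington1982, §2] -/
theorem Xw_nonneg (n : ℕ) (hy : 0 ≤ y) : 0 ≤ Xw n y := Finset.sum_nonneg fun _ _ => pow_nonneg hy _

open Classical in
/-- `X_n(y) ≤ A_n(y)`. [cite: HammersleyTorrieWhittington1982, §2] -/
theorem Xw_le_Aw (n : ℕ) (hy : 0 ≤ y) : Xw n y ≤ Aw n y :=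
  Finset.sum_le_sum_of_subset_of_nonneg archsX_subset fun _ _ _ => pow_nonneg hy _

/-- **Every wall bridge is extendable**: its endpoint is the rightmost column, so the row site one step further right is fresh.
[cite: HammersleyTorrieWhittington1982, §2 (surface bridges); BeatonBousquetMelouDeGierDuminilCopinGuttmann2014, §3.1 (arXiv v5 p. 9)] -/
theorem extRow_of_mem_wbr (hω : ω ∈ wbr n) : ExtRow n ω := by
  obtain ⟨hωa, hwb⟩ := mem_wbr.1 hω
  obtain ⟨hωh, -, hend⟩ := mem_archs.1 hωa
  refine ⟨Arm.pt (ω n 0 + 1) 0, ?_, Arm.pt_apply_one _ _, fun i hi h => ?_⟩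
  · rw [brickWallGraph_adj_coord, Arm.pt_apply_zero, Arm.pt_apply_one]
    omega
  · have h0 := congrFun h 0
    rw [Arm.pt_apply_zero] at h0
    have := (hwb i hi).2
    omega

open Classical in
/-- `wbr n ⊆ archsX n`. [cite: HammersleyTorrieWhittington1982, §2 (surface bridges)] -/
theorem wbr_subset_archsX : wbr n ⊆ archsX n := fun _ hω => mem_archsX.2 ⟨wbr_subset hω, extRow_of_mem_wbr hω⟩

open Classical in
/-- **`B^w_n(y) ≤ X_n(y)`** (`y ≥ 0`). [cite: HammersleyTorrieWhittington1982, §2 (surface bridges)] -/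
theorem WB_le_Xw (n : ℕ) (hy : 0 ≤ y) : WB n y ≤ Xw n y :=
  Finset.sum_le_sum_of_subset_of_nonneg wbr_subset_archsX fun _ _ _ => pow_nonneg hy _

/-! ### §2  Prefixes cut at a non-final surface visit are extendable arches -/

/-- **The prefix of a half-plane walk up to a surface visit at an even time `k < n` is an EXTENDABLE arch** (witness: the next vertex
`ω (k+1)`, which lies on the row by `surface_next_step` and is fresh by self-avoidance), with the same visits up to time `k`.
[cite: MadrasSlade1993, §1.2, (1.2.3); EntingJensen2009, §7.4.2, Fig. 7.10] -/
theorem prefixWalk_mem_archsX (hω : ω ∈ hpw n) {k : ℕ} (hk : k < n) (hk2 : k % 2 = 0) (hY : ω k 1 = 0) :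
    Zd.prefixWalk k ω ∈ archsX k ∧ visits k (Zd.prefixWalk k ω) = visits k ω := by
  classical
  obtain ⟨hpa, hpv⟩ := prefixWalk_mem_archs hω hk.le hk2 hY
  refine ⟨mem_archsX.2 ⟨hpa, ?_⟩, hpv⟩
  obtain ⟨hωs, -⟩ := mem_hpw.1 hω
  obtain ⟨-, -, hbw, hinj⟩ := mem_saws_iff.1 hωs
  have hv : ∀ i ≤ k, Zd.prefixWalk k ω i = ω i := fun i hi => by simp [Zd.prefixWalk, min_eq_left hi]
  obtain ⟨hY1, -⟩ := surface_next_step hω hk hk2 hY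
  refine ⟨ω (k + 1), ?_, hY1, fun i hi h => ?_⟩
  · rw [hv k le_rfl]; exact hbw k hk
  · rw [hv i hi] at h
    have := hinj (show i ∈ {j | j ≤ n} by simp only [Set.mem_setOf_eq]; omega)
      (show k + 1 ∈ {j | j ≤ n} by simp only [Set.mem_setOf_eq]; omega) h
    omega

/-! ### §3  The last-visit fibres, with extendable prefixes -/

open Classical in
/-- **The walks of `hpw n` with last surface visit at time `k < n` weigh at most `X_k(y) · c_{n−k}(ℍ)`** — the prefix/suffix injection of
`HexSAWSurfaceWallBridges` (`sum_fibre_lastV_le`), the prefix now landing in the EXTENDABLE arches.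
[cite: HammersleyTorrieWhittington1982, §2; MadrasSlade1993, §1.2, (1.2.3)] -/
theorem sum_fibre_lastV_le_X (hy : 0 ≤ y) {k : ℕ} (hk : k < n) :
    ∑ ω ∈ (hpw n).filter (fun ω => lastV n ω = k), y ^ visits n ω ≤ Xw k y * #(saws (n - k)) := by
  set F := (hpw n).filter (fun ω => lastV n ω = k)
  have hF : ∀ ω ∈ F, ω ∈ hpw n ∧ lastV n ω = k := fun ω hω => Finset.mem_filter.1 hω
  have hprops : ∀ ω ∈ F, visits n ω = visits k (Zd.prefixWalk k ω) ∧
      Zd.prefixWalk k ω ∈ archsX k ∧ Zd.suffixWalk k (n - k) ω ∈ saws (n - k) := by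
    intro ω hω
    obtain ⟨hωh, hl⟩ := hF ω hω
    have hωs := hpw_subset hωh
    obtain ⟨h0, -, -, -⟩ := mem_saws_iff.1 hωs
    obtain ⟨hk2, hY⟩ := lastV_spec (n := n) h0
    rw [hl] at hk2 hY
    obtain ⟨hpa, hpv⟩ := prefixWalk_mem_archsX hωh hk hk2 hY
    refine ⟨?_, hpa, suffixWalk_mem hωs hk.le hk2⟩
    have e := visits_add_eq_left (k := k) (b := n - k) (ζ := ω)
      (fun j hj1 hjb => not_visit_of_lastV_lt (n := n) (ω := ω) (by omega) (by omega))
    rw [Nat.add_sub_cancel' hk.le] at e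
    rw [hpv, e]
  have hinj : Set.InjOn (fun ω : ℕ → Site 2 => (Zd.prefixWalk k ω, Zd.suffixWalk k (n - k) ω)) ↑F :=
    fun ω hω ω' hω' h => Zd.prefix_suffix_injOn hk.le (saws_subset _ (hpw_subset (hF ω hω).1))
      (saws_subset _ (hpw_subset (hF ω' hω').1)) h
  calc ∑ ω ∈ F, y ^ visits n ω = ∑ ω ∈ F, y ^ visits k (Zd.prefixWalk k ω) :=
        Finset.sum_congr rfl fun ω hω => by rw [(hprops ω hω).1]
    _ = ∑ p ∈ F.image (fun ω => (Zd.prefixWalk k ω, Zd.suffixWalk k (n - k) ω)), y ^ visits k p.1 := by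
        rw [Finset.sum_image hinj]
    _ ≤ ∑ p ∈ archsX k ×ˢ saws (n - k), y ^ visits k p.1 := by
        refine Finset.sum_le_sum_of_subset_of_nonneg (fun p hp => ?_) fun _ _ _ => pow_nonneg hy _
        obtain ⟨ω, hω, rfl⟩ := Finset.mem_image.1 hp
        exact Finset.mem_product.2 ⟨(hprops ω hω).2.1, (hprops ω hω).2.2⟩
    _ = Xw k y * #(saws (n - k)) := by
        rw [Finset.sum_product, Xw, Finset.sum_mul]
        refine Finset.sum_congr rfl fun φ _ => ?_
        dsimp only
        rw [Finset.sum_const, nsmul_eq_mul, mul_comm]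

open Classical in
/-- **Every fibre `k ≤ m+2` of the arches of length `m+4`** weighs at most `2y · X_k(y) · c_{m+3−k}(ℍ)` (the parent file's `sum_fibW_le`
with the extendable prefix count). [cite: HammersleyTorrieWhittington1982, §2 (as summarised by Beaton 2014 arXiv v3 p. 11; locator provisional); MadrasSlade1993, §1.2, (1.2.3)] -/
theorem sum_fibW_le_X (m : ℕ) (hy : 0 ≤ y) {k : ℕ} (hk : k ≤ m + 2) :
    ∑ ω ∈ fibW m k, y ^ visits (m + 4) ω ≤ 2 * y * (Xw k y * #(saws (m + 3 - k))) := by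
  set F := (hpw (m + 3)).filter (fun ξ => lastV (m + 3) ξ = k) with hF
  set g : (ℕ → Site 2) → (ℕ → Site 2) × Bool :=
    fun ω => (Zd.prefixWalk (m + 3) ω, decide (ω (m + 4) 0 = ω (m + 3) 0 + 1)) with hg
  have hprops : ∀ ω ∈ fibW m k, (g ω).1 ∈ F ∧ visits (m + 4) ω = visits (m + 3) (g ω).1 + 1 := by
    intro ω hω
    obtain ⟨hωh, hm, hend, -, -, -, -, hlast⟩ := fibW_anatomy hω
    obtain ⟨hph, hpv⟩ := prefixWalk_mem_hpw hωh (show m + 3 ≤ m + 4 by omega)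
    have hl3 : lastV (m + 3) ω = k := by
      rw [show m + 3 = m + 2 + 1 by omega, lastV_succ_of_even (by omega), hlast]
    refine ⟨Finset.mem_filter.2 ⟨hph, (lastV_prefixWalk_eq _ _).trans hl3⟩, ?_⟩
    rw [show m + 4 = m + 3 + 1 by omega, visits_succ, hpv]
    have h4 : (m + 3 + 1) % 2 = 0 ∧ ω (m + 3 + 1) 1 = 0 := ⟨by omega, by rw [show m + 3 + 1 = m + 4 by omega]; exact hend⟩
    rw [if_pos h4]
  have hinj : Set.InjOn g ↑(fibW m k) := by
    intro ω hω ω' hω' h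
    rw [Finset.mem_coe] at hω hω'
    obtain ⟨hωh, -, hend, -⟩ := fibW_anatomy hω
    obtain ⟨hωh', -, hend', -⟩ := fibW_anatomy hω'
    have hωs := hpw_subset hωh
    have hωs' := hpw_subset hωh'
    simp only [hg, Prod.mk.injEq] at h
    obtain ⟨h1, h2⟩ := h
    have hagree : ∀ i ≤ m + 3, ω i = ω' i := fun i hi => by
      have := congrFun h1 i
      simpa [Zd.prefixWalk, min_eq_left hi] using this
    have hωa : ω ∈ archs (m + 3 + 1) := by rw [show m + 3 + 1 = m + 4 by omega]; exact (Finset.mem_filter.1 hω).1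
    have hωa' : ω' ∈ archs (m + 3 + 1) := by rw [show m + 3 + 1 = m + 4 by omega]; exact (Finset.mem_filter.1 hω').1
    obtain ⟨-, hX⟩ := arch_last_step hωa
    obtain ⟨-, hX'⟩ := arch_last_step hωa'
    rw [show m + 3 + 1 = m + 4 by omega] at hX hX'
    have e3 : ω (m + 3) 0 = ω' (m + 3) 0 := by rw [hagree (m + 3) le_rfl]
    have hb : (ω (m + 4) 0 = ω (m + 3) 0 + 1) ↔ (ω' (m + 4) 0 = ω' (m + 3) 0 + 1) := by
      simpa using h2
    refine Arm.eq_of_agree hωs hωs' fun i hi => ?_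
    rcases Nat.lt_or_ge i (m + 4) with hi' | hi'
    · exact hagree i (by omega)
    · have hin : i = m + 4 := le_antisymm hi hi'
      rw [hin, site_two_eq_iff]
      refine ⟨?_, by rw [hend, hend']⟩
      rcases hX with hX | hX <;> rcases hX' with hX' | hX'
      · omega
      · exact absurd (hb.1 hX) (by omega)
      · exact absurd (hb.2 hX') (by omega)
      · omega
  calc ∑ ω ∈ fibW m k, y ^ visits (m + 4) ω = ∑ ω ∈ fibW m k, y * y ^ visits (m + 3) (g ω).1 :=
        Finset.sum_congr rfl fun ω hω => by rw [(hprops ω hω).2, pow_succ, mul_comm]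
    _ = ∑ p ∈ (fibW m k).image g, y * y ^ visits (m + 3) p.1 := by rw [Finset.sum_image hinj]
    _ ≤ ∑ p ∈ F ×ˢ (Finset.univ : Finset Bool), y * y ^ visits (m + 3) p.1 := by
        refine Finset.sum_le_sum_of_subset_of_nonneg (fun p hp => ?_) fun _ _ _ => mul_nonneg hy (pow_nonneg hy _)
        obtain ⟨ω, hω, rfl⟩ := Finset.mem_image.1 hp
        exact Finset.mem_product.2 ⟨(hprops ω hω).1, Finset.mem_univ _⟩
    _ = 2 * y * ∑ ξ ∈ F, y ^ visits (m + 3) ξ := by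
        rw [Finset.sum_product, Finset.mul_sum]
        refine Finset.sum_congr rfl fun ξ _ => ?_
        simp only [Finset.sum_const, Finset.card_univ, Fintype.card_bool, nsmul_eq_mul]
        push_cast
        ring
    _ ≤ 2 * y * (Xw k y * #(saws (m + 3 - k))) :=
        mul_le_mul_of_nonneg_left (sum_fibre_lastV_le_X (n := m + 3) hy (by omega)) (by positivity)

open Classical in
/-- **The straight fibre** weighs at most `y · X_{m+2}(y)`: the parent's `sum_fibW_self_le`, the prefix `ω|[0,m+2]` being extendable
(witness `ω (m+3)`). [cite: BeatonBousquetMelouDeGierDuminilCopinGuttmann2014, §3.1 (arXiv v5 p. 9: walks sticking to the surface); EntingJensen2009, §7.4.2, Fig. 7.10] -/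
theorem sum_fibW_self_le_X (m : ℕ) (hy : 0 ≤ y) : ∑ ω ∈ fibW m (m + 2), y ^ visits (m + 4) ω ≤ y * Xw (m + 2) y := by
  set g : (ℕ → Site 2) → (ℕ → Site 2) := fun ω => Zd.prefixWalk (m + 2) ω with hg
  have hcoord : ∀ ω ∈ fibW m (m + 2), ω (m + 3) 0 = 2 * ω (m + 2) 0 - ω (m + 1) 0 ∧ ω (m + 3) 1 = 0 ∧
      ω (m + 4) 0 = 2 * ω (m + 3) 0 - ω (m + 2) 0 ∧ ω (m + 4) 1 = 0 := by
    intro ω hω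
    obtain ⟨hωh, hm, hend, -, -, hkY, -, -⟩ := fibW_anatomy hω
    obtain ⟨hωs, -⟩ := mem_hpw.1 hωh
    obtain ⟨-, -, -, hinj⟩ := mem_saws_iff.1 hωs
    have hωa : ω ∈ archs (m + 3 + 1) := by
      rw [show m + 3 + 1 = m + 4 by omega]; exact (Finset.mem_filter.1 hω).1
    obtain ⟨hY3, hX4⟩ := arch_last_step hωa
    obtain ⟨-, hX3⟩ := surface_next_step hωh (i := m + 2) (by omega) (by omega) hkY
    obtain ⟨hY1, hX1⟩ := surface_prev_step hωh (i := m + 1) (by omega) (by omega)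
      (by rw [show m + 1 + 1 = m + 2 by omega]; exact hkY)
    rw [show m + 2 + 1 = m + 3 by omega] at hX3
    rw [show m + 1 + 1 = m + 2 by omega] at hX1
    rw [show m + 3 + 1 = m + 4 by omega] at hX4
    have hne13 : ω (m + 1) ≠ ω (m + 3) := fun h => by
      have := hinj (show m + 1 ∈ {j | j ≤ m + 4} by simp only [Set.mem_setOf_eq]; omega)
        (show m + 3 ∈ {j | j ≤ m + 4} by simp only [Set.mem_setOf_eq]; omega) h
      omega
    have hne24 : ω (m + 2) ≠ ω (m + 4) := fun h => by
      have := hinj (show m + 2 ∈ {j | j ≤ m + 4} by simp only [Set.mem_setOf_eq]; omega)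
        (show m + 4 ∈ {j | j ≤ m + 4} by simp only [Set.mem_setOf_eq]; exact le_rfl) h
      omega
    have hne13' : ω (m + 1) 0 ≠ ω (m + 3) 0 := fun h => hne13 ((site_two_eq_iff _ _).2 ⟨h, by rw [hY1, hY3]⟩)
    have hne24' : ω (m + 2) 0 ≠ ω (m + 4) 0 := fun h => hne24 ((site_two_eq_iff _ _).2 ⟨h, by rw [hkY, hend]⟩)
    refine ⟨by omega, hY3, by omega, hend⟩
  have hprops : ∀ ω ∈ fibW m (m + 2), g ω ∈ archsX (m + 2) ∧ visits (m + 4) ω = visits (m + 2) (g ω) + 1 := by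
    intro ω hω
    obtain ⟨hωh, hm, hend, -, -, hkY, -, -⟩ := fibW_anatomy hω
    obtain ⟨hpa, hpv⟩ := prefixWalk_mem_archsX hωh (show m + 2 < m + 4 by omega) (by omega) hkY
    refine ⟨hpa, ?_⟩
    rw [show m + 4 = m + 3 + 1 by omega, visits_succ, show m + 3 = m + 2 + 1 by omega, visits_succ, hpv]
    have h3 : ¬ ((m + 2 + 1) % 2 = 0 ∧ ω (m + 2 + 1) 1 = 0) := fun h => by omega
    have h4 : (m + 2 + 1 + 1) % 2 = 0 ∧ ω (m + 2 + 1 + 1) 1 = 0 :=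
      ⟨by omega, by rw [show m + 2 + 1 + 1 = m + 4 by omega]; exact hend⟩
    rw [if_neg h3, if_pos h4]
  have hinj : Set.InjOn g ↑(fibW m (m + 2)) := by
    intro ω hω ω' hω' h
    rw [Finset.mem_coe] at hω hω'
    have hc := hcoord ω hω
    have hc' := hcoord ω' hω'
    have hωs := hpw_subset (fibW_anatomy hω).1
    have hωs' := hpw_subset (fibW_anatomy hω').1
    have hagree : ∀ i ≤ m + 2, ω i = ω' i := fun i hi => by
      have := congrFun h i
      simpa [hg, Zd.prefixWalk, min_eq_left hi] using this
    have e1 : ω (m + 1) 0 = ω' (m + 1) 0 := by rw [hagree (m + 1) (by omega)]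
    have e2 : ω (m + 2) 0 = ω' (m + 2) 0 := by rw [hagree (m + 2) le_rfl]
    refine Arm.eq_of_agree hωs hωs' fun i hi => ?_
    rcases Nat.lt_or_ge i (m + 3) with hi' | hi'
    · exact hagree i (by omega)
    · rw [site_two_eq_iff]
      obtain ⟨a0, a1, b0, b1⟩ := hc
      obtain ⟨a0', a1', b0', b1'⟩ := hc'
      have hcase : i = m + 3 ∨ i = m + 4 := by omega
      rcases hcase with rfl | rfl
      · exact ⟨by rw [a0, a0', e1, e2], by rw [a1, a1']⟩
      · exact ⟨by rw [b0, b0', a0, a0', e1, e2], by rw [b1, b1']⟩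
  calc ∑ ω ∈ fibW m (m + 2), y ^ visits (m + 4) ω = ∑ ω ∈ fibW m (m + 2), y * y ^ visits (m + 2) (g ω) :=
        Finset.sum_congr rfl fun ω hω => by rw [(hprops ω hω).2, pow_succ, mul_comm]
    _ = y * ∑ ξ ∈ (fibW m (m + 2)).image g, y ^ visits (m + 2) ξ := by rw [Finset.mul_sum, Finset.sum_image hinj]
    _ ≤ y * Xw (m + 2) y := by
        refine mul_le_mul_of_nonneg_left ?_ hy
        rw [Xw]
        refine Finset.sum_le_sum_of_subset_of_nonneg (fun ξ hξ => ?_) fun _ _ _ => pow_nonneg hy _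
        obtain ⟨ω, hω, rfl⟩ := Finset.mem_image.1 hξ
        exact (hprops ω hω).1

/-! ### §4  The dip fibre `k = m − 2`: an EXTENDABLE arch ending six steps after its last surface visit ends with the forward dip -/

open Classical in
/-- **Anatomy of the dip fibre under extendability.**  Let `ω ∈ fibW (j+4) (j+2)` (an arch of length `j+8` whose last surface visit before
the end is at time `j+2 ≥ 2`) be extendable along the row.  With `x = X_{j+2}` and `x' = X_{j+1}` (the previous row vertex, so `σ = x − x' = ±1`
is the direction of travel) the last six steps are FORCED: `(x+σ,0) (x+σ,−1) (x+2σ,−1) (x+3σ,−1) (x+3σ,0) (x+4σ,0)` — the forward dip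
around one hexagon.  (Going back under the start returns to `ω (j+1)`; the «hook» ending `(x+3σ,0) → (x+2σ,0)` is a dead end, excluded by
extendability; deeper excursions are too long.) [cite: EntingJensen2009, §7.4.2, Fig. 7.10 (brickwork form of the honeycomb lattice); BeatonBousquetMelouDeGierDuminilCopinGuttmann2014, §3.1 (arXiv v5 p. 9: walks sticking to the surface)] -/
theorem dip_coords {j : ℕ} (hω : ω ∈ fibW (j + 4) (j + 2)) (hE : ExtRow (j + 8) ω) :
    ω (j + 1) 1 = 0 ∧
    (ω (j + 3) 0 = 2 * ω (j + 2) 0 - ω (j + 1) 0 ∧ ω (j + 3) 1 = 0) ∧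
    (ω (j + 4) 0 = 2 * ω (j + 2) 0 - ω (j + 1) 0 ∧ ω (j + 4) 1 = -1) ∧
    (ω (j + 5) 0 = 3 * ω (j + 2) 0 - 2 * ω (j + 1) 0 ∧ ω (j + 5) 1 = -1) ∧
    (ω (j + 6) 0 = 4 * ω (j + 2) 0 - 3 * ω (j + 1) 0 ∧ ω (j + 6) 1 = -1) ∧
    (ω (j + 7) 0 = 4 * ω (j + 2) 0 - 3 * ω (j + 1) 0 ∧ ω (j + 7) 1 = 0) ∧
    (ω (j + 8) 0 = 5 * ω (j + 2) 0 - 4 * ω (j + 1) 0 ∧ ω (j + 8) 1 = 0) := by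
  have hω' : ω ∈ fibW (j + 4) (j + 2) := hω
  obtain ⟨hωh, -, hend, -, hk2, hkY, hno, -⟩ := fibW_anatomy hω'
  rw [show j + 4 + 4 = j + 8 by omega] at hωh hend
  obtain ⟨hωs, hH⟩ := mem_hpw.1 hωh
  obtain ⟨-, -, hbw, hinj⟩ := mem_saws_iff.1 hωs
  have hne : ∀ a b : ℕ, a ≤ j + 8 → b ≤ j + 8 → a ≠ b → ¬ (ω a 0 = ω b 0 ∧ ω a 1 = ω b 1) := by
    intro a b ha hb hab h
    have := hinj (show a ∈ {i | i ≤ j + 8} by simp only [Set.mem_setOf_eq]; exact ha)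
      (show b ∈ {i | i ≤ j + 8} by simp only [Set.mem_setOf_eq]; exact hb) ((site_two_eq_iff _ _).2 h)
    exact hab this
  -- the previous row vertex and the next one
  obtain ⟨hY1, hX2⟩ := surface_prev_step hωh (i := j + 1) (by omega) (by omega)
    (by rw [show j + 1 + 1 = j + 2 by omega]; exact hkY)
  rw [show j + 1 + 1 = j + 2 by omega] at hX2
  obtain ⟨hY3, hX3⟩ := surface_next_step hωh (i := j + 2) (by omega) hk2 hkY
  rw [show j + 2 + 1 = j + 3 by omega] at hY3 hX3
  have h13 := hne (j + 3) (j + 1) (by omega) (by omega) (by omega)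
  have hX3' : ω (j + 3) 0 = 2 * ω (j + 2) 0 - ω (j + 1) 0 := by omega
  -- time `j+4`: down
  have hn4 : ¬ (ω (j + 4) 1 = 0) := fun h => hno (j + 4) (by omega) (by omega) ⟨by omega, h⟩
  have s4 := Arm.step_cases (hbw (j + 3) (by omega))
  rw [show j + 3 + 1 = j + 4 by omega] at s4
  have hH4 := hH (j + 4) (by omega)
  have hX4 : ω (j + 4) 0 = ω (j + 3) 0 := by omega
  have hY4 : ω (j + 4) 1 = -1 := by omega
  have hP4 : (ω (j + 4) 0 + ω (j + 4) 1) % 2 = 0 := by omega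
  -- time `j+5`: along the lower row
  have s5 := Arm.step_cases (hbw (j + 4) (by omega))
  rw [show j + 4 + 1 = j + 5 by omega] at s5
  have h53 := hne (j + 5) (j + 3) (by omega) (by omega) (by omega)
  have hY5 : ω (j + 5) 1 = -1 := by omega
  have hX5 : ω (j + 5) 0 = ω (j + 4) 0 + 1 ∨ ω (j + 4) 0 = ω (j + 5) 0 + 1 := by omega
  -- time `j+7` is on the row (vertex before the end of an arch), so time `j+6` is at height `-1`
  have hωa : ω ∈ archs (j + 7 + 1) := by
    rw [show j + 7 + 1 = j + 4 + 4 by omega]; exact (Finset.mem_filter.1 hω').1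
  obtain ⟨hY7, hX8⟩ := arch_last_step hωa
  rw [show j + 7 + 1 = j + 8 by omega] at hX8
  have hn6 : ¬ (ω (j + 6) 1 = 0) := fun h => hno (j + 6) (by omega) (by omega) ⟨by omega, h⟩
  have s6 := Arm.step_cases (hbw (j + 5) (by omega))
  rw [show j + 5 + 1 = j + 6 by omega] at s6
  have s7 := Arm.step_cases (hbw (j + 6) (by omega))
  rw [show j + 6 + 1 = j + 7 by omega] at s7
  have hY6 : ω (j + 6) 1 = -1 := by omega
  have hX6 : ω (j + 6) 0 = ω (j + 5) 0 + 1 ∨ ω (j + 5) 0 = ω (j + 6) 0 + 1 := by omega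
  have hX7 : ω (j + 7) 0 = ω (j + 6) 0 := by omega
  have hP6 : (ω (j + 6) 0 + ω (j + 6) 1) % 2 = 0 := by omega
  -- directions: not back under the start (that returns to `ω (j+1)`), not onto `ω (j+4)`
  have h64 := hne (j + 6) (j + 4) (by omega) (by omega) (by omega)
  have h71 := hne (j + 7) (j + 1) (by omega) (by omega) (by omega)
  have hX5' : ω (j + 5) 0 = 3 * ω (j + 2) 0 - 2 * ω (j + 1) 0 := by omega
  have hX6' : ω (j + 6) 0 = 4 * ω (j + 2) 0 - 3 * ω (j + 1) 0 := by omega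
  -- the end: the hook `(x+2σ, 0)` is a dead end, excluded by extendability
  have hX8' : ω (j + 8) 0 = 5 * ω (j + 2) 0 - 4 * ω (j + 1) 0 := by
    by_contra h8
    -- then the end is the hook `(x+2σ, 0)`, whose two row-neighbours `ω (j+3)`, `ω (j+7)` are visited
    have hhook : ω (j + 8) 0 = 3 * ω (j + 2) 0 - 2 * ω (j + 1) 0 := by omega
    obtain ⟨z, hz, hz1, hzne⟩ := hE
    rw [brickWallGraph_adj_coord] at hz
    have hz0 : z 0 = ω (j + 3) 0 ∨ z 0 = ω (j + 7) 0 := by omega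
    rcases hz0 with hz0 | hz0
    · exact hzne (j + 3) (by omega) ((site_two_eq_iff _ _).2 ⟨hz0.symm, by rw [hY3, hz1]⟩)
    · exact hzne (j + 7) (by omega) ((site_two_eq_iff _ _).2 ⟨hz0.symm, by rw [hY7, hz1]⟩)
  exact ⟨hY1, ⟨hX3', hY3⟩, ⟨by omega, hY4⟩, ⟨hX5', hY5⟩, ⟨hX6', hY6⟩, ⟨by omega, hY7⟩, ⟨hX8', hend⟩⟩

open Classical in
/-- **The dip fibre injects into the extendable arches six steps shorter, at the price of one visit**:
`Σ_{ω ∈ fibW (j+4) (j+2), extendable} y^{visits} ≤ y · X_{j+2}(y)` (`y ≥ 0`). [cite: HammersleyTorrieWhittington1982, §2 (as summarised by Beaton 2014 arXiv v3 p. 11; locator provisional); EntingJensen2009, §7.4.2, Fig. 7.10] -/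
theorem sum_fibW_dip_le_X (j : ℕ) (hy : 0 ≤ y) :
    ∑ ω ∈ (fibW (j + 4) (j + 2)).filter (ExtRow (j + 8)), y ^ visits (j + 8) ω ≤ y * Xw (j + 2) y := by
  set D := (fibW (j + 4) (j + 2)).filter (ExtRow (j + 8)) with hD
  set g : (ℕ → Site 2) → (ℕ → Site 2) := fun ω => Zd.prefixWalk (j + 2) ω with hg
  have hmemD : ∀ ω ∈ D, ω ∈ fibW (j + 4) (j + 2) ∧ ExtRow (j + 8) ω := fun ω hω => Finset.mem_filter.1 hω
  have hprops : ∀ ω ∈ D, g ω ∈ archsX (j + 2) ∧ visits (j + 8) ω = visits (j + 2) (g ω) + 1 := by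
    intro ω hω
    obtain ⟨hωf, -⟩ := hmemD ω hω
    obtain ⟨hωh, -, hend, -, hk2, hkY, hno, -⟩ := fibW_anatomy hωf
    rw [show j + 4 + 4 = j + 8 by omega] at hωh hend
    obtain ⟨hpa, hpv⟩ := prefixWalk_mem_archsX hωh (show j + 2 < j + 8 by omega) hk2 hkY
    refine ⟨hpa, ?_⟩
    have e := visits_add_eq_left (k := j + 2) (b := 5) (ζ := ω) (fun i hi1 hi5 h => by
      have hi : i = 2 ∨ i = 4 := by omega
      rcases hi with rfl | rfl
      · exact hno (j + 4) (by omega) (by omega) ⟨by omega, by rw [show j + 4 = j + 2 + 2 by omega]; exact h.2⟩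
      · exact hno (j + 6) (by omega) (by omega) ⟨by omega, by rw [show j + 6 = j + 2 + 4 by omega]; exact h.2⟩)
    rw [show j + 8 = j + 2 + 5 + 1 by omega, visits_succ, e, hpv]
    have h8 : (j + 2 + 5 + 1) % 2 = 0 ∧ ω (j + 2 + 5 + 1) 1 = 0 :=
      ⟨by omega, by rw [show j + 2 + 5 + 1 = j + 8 by omega]; exact hend⟩
    rw [if_pos h8]
  have hinj : Set.InjOn g ↑D := by
    intro ω hω ω' hω' h
    rw [Finset.mem_coe] at hω hω'
    obtain ⟨hωf, hE⟩ := hmemD ω hω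
    obtain ⟨hωf', hE'⟩ := hmemD ω' hω'
    have hc := dip_coords hωf hE
    have hc' := dip_coords hωf' hE'
    have hωs : ω ∈ saws (j + 8) := by
      have := (fibW_anatomy hωf).1; rw [show j + 4 + 4 = j + 8 by omega] at this; exact hpw_subset this
    have hωs' : ω' ∈ saws (j + 8) := by
      have := (fibW_anatomy hωf').1; rw [show j + 4 + 4 = j + 8 by omega] at this; exact hpw_subset this
    have hagree : ∀ i ≤ j + 2, ω i = ω' i := fun i hi => by
      have := congrFun h i
      simpa [hg, Zd.prefixWalk, min_eq_left hi] using this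
    have e1 : ω (j + 1) 0 = ω' (j + 1) 0 := by rw [hagree (j + 1) (by omega)]
    have e2 : ω (j + 2) 0 = ω' (j + 2) 0 := by rw [hagree (j + 2) le_rfl]
    obtain ⟨-, ⟨a0, a1⟩, ⟨b0, b1⟩, ⟨c0, c1⟩, ⟨d0, d1⟩, ⟨f0, f1⟩, ⟨g0, g1⟩⟩ := hc
    obtain ⟨-, ⟨a0', a1'⟩, ⟨b0', b1'⟩, ⟨c0', c1'⟩, ⟨d0', d1'⟩, ⟨f0', f1'⟩, ⟨g0', g1'⟩⟩ := hc'
    refine Arm.eq_of_agree hωs hωs' fun i hi => ?_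
    rcases Nat.lt_or_ge i (j + 3) with hi' | hi'
    · exact hagree i (by omega)
    · rw [site_two_eq_iff]
      have hcase : i = j + 3 ∨ i = j + 4 ∨ i = j + 5 ∨ i = j + 6 ∨ i = j + 7 ∨ i = j + 8 := by omega
      rcases hcase with rfl | rfl | rfl | rfl | rfl | rfl
      · exact ⟨by rw [a0, a0', e1, e2], by rw [a1, a1']⟩
      · exact ⟨by rw [b0, b0', e1, e2], by rw [b1, b1']⟩
      · exact ⟨by rw [c0, c0', e1, e2], by rw [c1, c1']⟩
      · exact ⟨by rw [d0, d0', e1, e2], by rw [d1, d1']⟩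
      · exact ⟨by rw [f0, f0', e1, e2], by rw [f1, f1']⟩
      · exact ⟨by rw [g0, g0', e1, e2], by rw [g1, g1']⟩
  calc ∑ ω ∈ D, y ^ visits (j + 8) ω = ∑ ω ∈ D, y * y ^ visits (j + 2) (g ω) :=
        Finset.sum_congr rfl fun ω hω => by rw [(hprops ω hω).2, pow_succ, mul_comm]
    _ = y * ∑ ξ ∈ D.image g, y ^ visits (j + 2) ξ := by rw [Finset.mul_sum, Finset.sum_image hinj]
    _ ≤ y * Xw (j + 2) y := by
        refine mul_le_mul_of_nonneg_left ?_ hy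
        rw [Xw]
        refine Finset.sum_le_sum_of_subset_of_nonneg (fun ξ hξ => ?_) fun _ _ _ => pow_nonneg hy _
        obtain ⟨ω, hω, rfl⟩ := Finset.mem_image.1 hξ
        exact (hprops ω hω).1

/-! ### §5  The empty fibres `k ∈ {m−1, m, m+1}` and the recursion for `X` -/

open Classical in
/-- **No arch has its last surface visit exactly four steps before its end** (`ω ∉ fibW m m`): it would leave the row downwards at
time `m+2` and be back on the row at time `m+3` along the SAME vertical bond (`ω (m+3) = ω (m+1)`).  Equivalently, off the zig-zag wall of
the honeycomb lattice the shortest excursion has length six.  (The lane's banked «SHARP-REC» of a-p5 states the same fact as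
`fibW m m = ∅`; this is an independent derivation, kept in the `∉` form.) [cite: EntingJensen2009, §7.4.2, Fig. 7.10 (brickwork form of the honeycomb lattice)] -/
theorem not_mem_fibW_diag (m : ℕ) (ω : ℕ → Site 2) : ω ∉ fibW m m := by
  intro hω
  obtain ⟨hωh, hm, -, -, -, hkY, hno, -⟩ := fibW_anatomy hω
  obtain ⟨hωs, hH⟩ := mem_hpw.1 hωh
  obtain ⟨-, -, hbw, hinj⟩ := mem_saws_iff.1 hωs
  obtain ⟨hY1, -⟩ := surface_next_step hωh (i := m) (by omega) hm hkY
  have hn2 : ¬ (ω (m + 2) 1 = 0) := fun h => hno (m + 2) (by omega) le_rfl ⟨by omega, h⟩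
  have s2 := Arm.step_cases (hbw (m + 1) (by omega))
  have hH2 := hH (m + 2) (by omega)
  rw [show m + 1 + 1 = m + 2 by omega] at s2
  have hωa : ω ∈ archs (m + 3 + 1) := by
    rw [show m + 3 + 1 = m + 4 by omega]; exact (Finset.mem_filter.1 hω).1
  obtain ⟨hY3, -⟩ := arch_last_step hωa
  have s3 := Arm.step_cases (hbw (m + 2) (by omega))
  rw [show m + 2 + 1 = m + 3 by omega] at s3
  have hX2 : ω (m + 2) 0 = ω (m + 1) 0 := by omega
  have hX3 : ω (m + 3) 0 = ω (m + 2) 0 := by omega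
  have heq : ω (m + 3) = ω (m + 1) := (site_two_eq_iff _ _).2 ⟨hX3.trans hX2, hY3.trans hY1.symm⟩
  have := hinj (show m + 3 ∈ {i | i ≤ m + 4} by simp only [Set.mem_setOf_eq]; omega)
    (show m + 1 ∈ {i | i ≤ m + 4} by simp only [Set.mem_setOf_eq]; omega) heq
  omega

open Classical in
/-- The three fibres next to the straight one carry no weight: `k = m ± 1` are odd (surface visits happen at even times), `k = m` is
`not_mem_fibW_diag`. [cite: EntingJensen2009, §7.4.2, Fig. 7.10; BeatonBousquetMelouDeGierDuminilCopinGuttmann2014, §3.1 (arXiv v5 p. 8: contacts with the surface)] -/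
theorem sum_fibW_eq_zero_of_near {m k : ℕ} (hk1 : m - 1 ≤ k) (hk2 : k ≤ m + 1) (y : ℝ) :
    ∑ ω ∈ fibW m k, y ^ visits (m + 4) ω = 0 := by
  refine Finset.sum_eq_zero fun ω hω => ?_
  exfalso
  by_cases hkm : k = m
  · subst hkm; exact not_mem_fibW_diag k ω hω
  · obtain ⟨-, hm, -, -, hk0, -⟩ := fibW_anatomy hω
    omega

open Classical in
/-- ★ **THE RECURSION FOR THE EXTENDABLE COUNT** (`y ≥ 0`, arches of length `j+8`):
`X_{j+8}(y) ≤ y · X_{j+6}(y) + y · X_{j+2}(y) + 2y · Σ_{k ≤ j} X_k(y) · c_{j+7−k}(ℍ)` — the straight block (factor `y`), the forward dip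
(factor `y`, ONE shape: the hook is not extendable), and the excursions of length `≥ 8` bounded by all walks.  Its characteristic equation
`1 = y z + y z³ + O(y z⁴)` at `z = 1/β²` is the renewal equation of the dilute defect gas truncated after the dip.
[cite: HammersleyTorrieWhittington1982, §2 (unfolded surface walks, as summarised by Beaton 2014 arXiv v3 p. 11; locator provisional); JansevanRensburg2000, §3.3.2, Lemma 3.20; MadrasSlade1993, §1.2, (1.2.3)] -/
theorem Xw_le_rec (j : ℕ) (hy : 0 ≤ y) :
    Xw (j + 8) y ≤ y * Xw (j + 6) y + y * Xw (j + 2) y + 2 * y * ∑ k ∈ range (j + 1), Xw k y * #(saws (j + 7 - k)) := by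
  classical
  set T : ℕ → ℝ := fun k => ∑ ω ∈ (archsX (j + 8)).filter (fun ω => lastV (j + 6) ω = k), y ^ visits (j + 8) ω with hT
  have hf : ∀ ω ∈ archsX (j + 8), lastV (j + 6) ω ∈ range (j + 7) :=
    fun ω _ => Finset.mem_range.2 (Nat.lt_succ_of_le (lastV_le _ _))
  have hX : Xw (j + 8) y = ∑ k ∈ range (j + 7), T k := by
    rw [Xw, ← Finset.sum_fiberwise_of_maps_to hf]
  have hsub : ∀ k, (archsX (j + 8)).filter (fun ω => lastV (j + 6) ω = k) ⊆ (fibW (j + 4) k).filter (ExtRow (j + 8)) := by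
    intro k ω hω
    obtain ⟨hωX, hl⟩ := Finset.mem_filter.1 hω
    obtain ⟨hωa, hE⟩ := mem_archsX.1 hωX
    refine Finset.mem_filter.2 ⟨Finset.mem_filter.2 ⟨?_, ?_⟩, hE⟩
    · rw [show j + 4 + 4 = j + 8 by omega]; exact hωa
    · rw [show j + 4 + 2 = j + 6 by omega]; exact hl
  have hTle : ∀ k, T k ≤ ∑ ω ∈ fibW (j + 4) k, y ^ visits (j + 8) ω := fun k =>
    Finset.sum_le_sum_of_subset_of_nonneg ((hsub k).trans (Finset.filter_subset _ _)) fun _ _ _ => pow_nonneg hy _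
  have hT0 : ∀ ω : ℕ → Site 2, visits (j + 4 + 4) ω = visits (j + 8) ω := fun ω => by rw [show j + 4 + 4 = j + 8 by omega]
  -- the straight fibre
  have h6 : T (j + 6) ≤ y * Xw (j + 6) y := by
    refine (hTle _).trans ?_
    have h := sum_fibW_self_le_X (j + 4) hy
    rw [show j + 4 + 2 = j + 6 by omega] at h
    simpa only [hT0] using h
  -- the three empty fibres and the odd fibre `j+1`
  have h5 : T (j + 5) ≤ 0 := (hTle _).trans (by
    have h := sum_fibW_eq_zero_of_near (m := j + 4) (k := j + 5) (by omega) (by omega) y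
    simpa only [hT0] using h.le)
  have h4 : T (j + 4) ≤ 0 := (hTle _).trans (by
    have h := sum_fibW_eq_zero_of_near (m := j + 4) (k := j + 4) (by omega) (by omega) y
    simpa only [hT0] using h.le)
  have h3 : T (j + 3) ≤ 0 := (hTle _).trans (by
    have h := sum_fibW_eq_zero_of_near (m := j + 4) (k := j + 3) (by omega) (by omega) y
    simpa only [hT0] using h.le)
  have h1 : T (j + 1) ≤ 0 := (hTle _).trans (by
    refine (Finset.sum_eq_zero fun ω hω => ?_).le
    obtain ⟨-, hm, -, -, hk0, -⟩ := fibW_anatomy hω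
    omega)
  -- the dip fibre
  have h2 : T (j + 2) ≤ y * Xw (j + 2) y :=
    (Finset.sum_le_sum_of_subset_of_nonneg (hsub (j + 2)) fun _ _ _ => pow_nonneg hy _).trans (sum_fibW_dip_le_X j hy)
  -- the long fibres
  have h0 : ∑ k ∈ range (j + 1), T k ≤ 2 * y * ∑ k ∈ range (j + 1), Xw k y * #(saws (j + 7 - k)) := by
    rw [Finset.mul_sum]
    refine Finset.sum_le_sum fun k hk => (hTle k).trans ?_
    have hk' := Finset.mem_range.1 hk
    have h := sum_fibW_le_X (j + 4) hy (k := k) (by omega)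
    rw [show j + 4 + 3 - k = j + 7 - k by omega] at h
    simpa only [hT0] using h
  rw [hX, Finset.sum_range_succ, Finset.sum_range_succ, Finset.sum_range_succ, Finset.sum_range_succ, Finset.sum_range_succ,
    Finset.sum_range_succ]
  linarith

/-! ### §6  The growth bound with the renewal-sharp condition `y/ρ² + y/ρ⁶ + 8748·y/ρ⁸ ≤ 1` -/

open Classical in
/-- A priori: `X_n(y) ≤ 3ⁿ yⁿ` for `y ≥ 1`. [cite: MadrasSlade1993, §1.2, (1.2.3)] -/
theorem Xw_le_three_pow_mul_pow (n : ℕ) (hy : 1 ≤ y) : Xw n y ≤ 3 ^ n * y ^ n := by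
  have hy0 : 0 ≤ y := by linarith
  have h1 := (Xw_le_Aw n hy0).trans (Aw_le_card_mul_pow n hy0)
  rw [max_eq_right hy] at h1
  exact h1.trans (mul_le_mul_of_nonneg_right (Arm.card_saws_le_three_pow n) (pow_nonneg hy0 _))

open Classical in
/-- **The growth bound** (`y ≥ 1`): if `ρ ≥ 6` and `y/ρ² + y/ρ⁶ + 8748·y/ρ⁸ ≤ 1` then `X_n(y) ≤ 2187 y⁷ · ρⁿ` for every `n` (strong induction
on `Xw_le_rec`; `c_m(ℍ) ≤ 3^m`; geometric tail `Σ_{k ≤ j} ρ^k 3^{j+7−k} ≤ 2·3⁷ ρ^j`; `8748 = 4·3⁷`, `2187 = 3⁷`).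
[cite: HammersleyTorrieWhittington1982, §2 (as summarised by Beaton 2014 arXiv v3 p. 11; locator provisional); MadrasSlade1993, §1.2, Lemma 1.2.2] -/
theorem Xw_le_mul_pow (hy : 1 ≤ y) {ρ : ℝ} (hρ : 6 ≤ ρ) (hc : y / ρ ^ 2 + y / ρ ^ 6 + 8748 * y / ρ ^ 8 ≤ 1) (n : ℕ) :
    Xw n y ≤ 2187 * y ^ 7 * ρ ^ n := by
  have hy0 : 0 ≤ y := by linarith
  have hρ1 : 1 ≤ ρ := by linarith
  have hρ0 : 0 < ρ := by linarith
  induction n using Nat.strong_induction_on with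
  | _ n ih =>
  rcases Nat.lt_or_ge n 8 with hn | hn
  · have h1 := Xw_le_three_pow_mul_pow n hy
    have h3 : (3 : ℝ) ^ n ≤ 2187 := by
      calc (3 : ℝ) ^ n ≤ 3 ^ 7 := pow_le_pow_right₀ (by norm_num) (by omega)
        _ = 2187 := by norm_num
    have h4 : y ^ n ≤ y ^ 7 := pow_le_pow_right₀ hy (by omega)
    have h5 : (1 : ℝ) ≤ ρ ^ n := one_le_pow₀ hρ1
    calc Xw n y ≤ 3 ^ n * y ^ n := h1
      _ ≤ 2187 * y ^ 7 := mul_le_mul h3 h4 (pow_nonneg hy0 _) (by norm_num)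
      _ = 2187 * y ^ 7 * 1 := (mul_one _).symm
      _ ≤ 2187 * y ^ 7 * ρ ^ n := mul_le_mul_of_nonneg_left h5 (by positivity)
  · obtain ⟨j, rfl⟩ : ∃ j, n = j + 8 := ⟨n - 8, by omega⟩
    set M : ℝ := 2187 * y ^ 7 with hM
    have hM0 : 0 ≤ M := by positivity
    have hrec := Xw_le_rec j hy0
    have b6 : Xw (j + 6) y ≤ M * ρ ^ (j + 6) := ih (j + 6) (by omega)
    have b2 : Xw (j + 2) y ≤ M * ρ ^ (j + 2) := ih (j + 2) (by omega)
    have bS : ∑ k ∈ range (j + 1), Xw k y * (#(saws (j + 7 - k)) : ℝ) ≤ M * (4374 * ρ ^ j) := by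
      calc ∑ k ∈ range (j + 1), Xw k y * (#(saws (j + 7 - k)) : ℝ)
          ≤ ∑ k ∈ range (j + 1), M * ρ ^ k * 3 ^ (j + 7 - k) := by
            refine Finset.sum_le_sum fun k hk => ?_
            exact mul_le_mul (ih k (by have := Finset.mem_range.1 hk; omega)) (Arm.card_saws_le_three_pow _)
              (by positivity) (by positivity)
        _ = M * ∑ k ∈ range (j + 1), ρ ^ k * 3 ^ (j + 7 - k) := by
            rw [Finset.mul_sum]; exact Finset.sum_congr rfl fun k _ => by ring
        _ ≤ M * (2 * 3 ^ 7 * ρ ^ j) := mul_le_mul_of_nonneg_left (Arm.sum_pow_mul_three_pow_le hρ j 7) hM0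
        _ = M * (4374 * ρ ^ j) := by norm_num
    have key : y * ρ ^ (j + 6) + y * ρ ^ (j + 2) + 8748 * y * ρ ^ j ≤ ρ ^ (j + 8) := by
      have h := mul_le_mul_of_nonneg_right hc (pow_nonneg hρ0.le (j + 8))
      rw [one_mul] at h
      have e : (y / ρ ^ 2 + y / ρ ^ 6 + 8748 * y / ρ ^ 8) * ρ ^ (j + 8) =
          y * ρ ^ (j + 6) + y * ρ ^ (j + 2) + 8748 * y * ρ ^ j := by
        field_simp
        ring
      linarith
    have c6 : y * Xw (j + 6) y ≤ y * (M * ρ ^ (j + 6)) := mul_le_mul_of_nonneg_left b6 hy0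
    have c2 : y * Xw (j + 2) y ≤ y * (M * ρ ^ (j + 2)) := mul_le_mul_of_nonneg_left b2 hy0
    have cS : 2 * y * ∑ k ∈ range (j + 1), Xw k y * (#(saws (j + 7 - k)) : ℝ) ≤ 2 * y * (M * (4374 * ρ ^ j)) :=
      mul_le_mul_of_nonneg_left bS (by positivity)
    have key' := mul_le_mul_of_nonneg_left key hM0
    calc Xw (j + 8) y
        ≤ y * Xw (j + 6) y + y * Xw (j + 2) y + 2 * y * ∑ k ∈ range (j + 1), Xw k y * (#(saws (j + 7 - k)) : ℝ) := hrec
      _ ≤ y * (M * ρ ^ (j + 6)) + y * (M * ρ ^ (j + 2)) + 2 * y * (M * (4374 * ρ ^ j)) := by linarith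
      _ = M * (y * ρ ^ (j + 6) + y * ρ ^ (j + 2) + 8748 * y * ρ ^ j) := by ring
      _ ≤ M * ρ ^ (j + 8) := key'

/-! ### §7  THE SHARP UPPER WINDOW `β(y)² ≤ y + 1/y + 8748/y²` for every `y ≥ 1` -/

/-- `36 ≤ y + 1/y + 8748/y²` for `y ≥ 1` (`y³ − 36y² + 8748 = (y−24)²(y+12) + 1836 > 0`), so that `ρ = √(y + 1/y + 8748/y²) ≥ 6` with no
threshold on the fugacity. [cite: MadrasSlade1993, §1.2, Lemma 1.2.2] -/
theorem thirtysix_le_sharpB (hy : 1 ≤ y) : (36 : ℝ) ≤ y + 1 / y + 8748 / y ^ 2 := by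
  have hy0 : 0 < y := by linarith
  have h1 : (0 : ℝ) ≤ 1 / y := by positivity
  have h2 : (36 : ℝ) ≤ y + 8748 / y ^ 2 := by
    rw [← sub_nonneg]
    have e : y + 8748 / y ^ 2 - 36 = ((y - 24) ^ 2 * (y + 12) + 1836) / y ^ 2 := by
      field_simp
      ring
    rw [e]
    positivity
  linarith

/-- ★★★ **THE SHARP UPPER WINDOW: `β(y)² ≤ y + 1/y + 8748/y²` for every `y ≥ 1`.**  With `B = y + 1/y + 8748/y²` and `ρ = √B` the
renewal-sharp condition `y B³ + y B + 8748 y ≤ B⁴` holds because `B⁴ − y B³ = B³ (1/y + 8748/y²) ≥ y B + 8748 y` (`B ≥ y`); then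
`B^w_n(y) ≤ X_n(y) ≤ 2187 y⁷ ρⁿ` and the Fekete transfer `wallRate_le_of_WB_le` give `β(y) ≤ ρ`.  Together with the lane's lower window
`β(y)² ≥ y + h/y − O(y⁻³)` (`h = hookConst = 1`, `HexSAWSurfaceHookRenewal` + §8) this pins the second-order coefficient: `β(y)² = y + 1/y +
O(y⁻²)`. [cite: BeatonBousquetMelouDeGierDuminilCopinGuttmann2014, §3.1 (arXiv v5 p. 10: "This translates into μ(y) ∼ √y in our honeycomb setting" — stated without proof); RychlewskiWhittington2011, Theorem (square-lattice analogue μ(y) ∼ y; not held); JansevanRensburg2000, §3.3.2, Lemma 3.20] -/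
theorem wallRate_sq_le_sharp (hy : 1 ≤ y) : wallRate y ^ 2 ≤ y + 1 / y + 8748 / y ^ 2 := by
  have hy0 : 0 < y := by linarith
  set B : ℝ := y + 1 / y + 8748 / y ^ 2 with hB
  have hB36 : 36 ≤ B := thirtysix_le_sharpB hy
  have hB0 : 0 < B := by linarith
  have hyB : y ≤ B := by
    have h1 : (0 : ℝ) ≤ 1 / y := by positivity
    have h2 : (0 : ℝ) ≤ 8748 / y ^ 2 := by positivity
    rw [hB]; linarith
  set ρ := Real.sqrt B with hρ
  have hρ0 : 0 < ρ := Real.sqrt_pos.2 hB0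
  have hρsq : ρ ^ 2 = B := Real.sq_sqrt hB0.le
  have hρ6 : 6 ≤ ρ := by
    rw [hρ, ← Real.sqrt_sq (by norm_num : (0 : ℝ) ≤ 6)]
    exact Real.sqrt_le_sqrt (by norm_num; exact hB36)
  have hc : y / ρ ^ 2 + y / ρ ^ 6 + 8748 * y / ρ ^ 8 ≤ 1 := by
    have h6 : ρ ^ 6 = B ^ 3 := by rw [show (6 : ℕ) = 2 * 3 by norm_num, pow_mul, hρsq]
    have h8 : ρ ^ 8 = B ^ 4 := by rw [show (8 : ℕ) = 2 * 4 by norm_num, pow_mul, hρsq]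
    rw [hρsq, h6, h8]
    have e : y / B + y / B ^ 3 + 8748 * y / B ^ 4 = (y * B ^ 3 + y * B + 8748 * y) / B ^ 4 := by
      field_simp
    rw [e, div_le_one (by positivity)]
    -- `B⁴ − y B³ = B³ (B − y) = B³ (1/y + 8748/y²) ≥ y B + 8748 y`
    have hBy : B - y = 1 / y + 8748 / y ^ 2 := by rw [hB]; ring
    have hB2 : y ^ 2 ≤ B ^ 2 := pow_le_pow_left₀ hy0.le hyB 2
    have hB3 : y ^ 3 ≤ B ^ 3 := pow_le_pow_left₀ hy0.le hyB 3
    have t1 : y * B ≤ B ^ 3 * (1 / y) := by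
      rw [mul_one_div, le_div_iff₀ hy0]; nlinarith
    have t2 : 8748 * y ≤ B ^ 3 * (8748 / y ^ 2) := by
      rw [mul_div_assoc', le_div_iff₀ (by positivity)]; nlinarith
    have key : y * B + 8748 * y ≤ B ^ 3 * (B - y) := by rw [hBy, mul_add]; linarith
    nlinarith
  have hA := Xw_le_mul_pow hy hρ6 hc
  have hW : ∀ n, WB n y ≤ 2187 * y ^ 7 * ρ ^ n := fun n => (WB_le_Xw n hy0.le).trans (hA n)
  have hβρ : wallRate y ≤ ρ := wallRate_le_of_WB_le hy0 (by positivity) hρ0 hW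
  calc wallRate y ^ 2 ≤ ρ ^ 2 := pow_le_pow_left₀ (wallRate_pos y).le hβρ 2
    _ = B := hρsq

/-- ★★ **`β(y)² − y − 1/y ≤ 8748/y²`** (`y ≥ 1`). [cite: BeatonBousquetMelouDeGierDuminilCopinGuttmann2014, §3.1 (arXiv v5 p. 10 remark); JansevanRensburg2000, §3.3.2, Lemma 3.20] -/
theorem wallRate_sq_sub_sub_le (hy : 1 ≤ y) : wallRate y ^ 2 - y - 1 / y ≤ 8748 / y ^ 2 := by
  have := wallRate_sq_le_sharp hy; linarith

/-- ★★ **`y · (β(y)² − y) ≤ 1 + 8748/y`** (`y ≥ 1`): `limsup_{y → ∞} y (β(y)² − y) ≤ 1`. [cite: BeatonBousquetMelouDeGierDuminilCopinGuttmann2014, §3.1 (arXiv v5 p. 10 remark); JansevanRensburg2000, §3.3.2, Lemma 3.20] -/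
theorem mul_wallRate_sq_sub_le (hy : 1 ≤ y) : y * (wallRate y ^ 2 - y) ≤ 1 + 8748 / y := by
  have hy0 : 0 < y := by linarith
  have h := mul_le_mul_of_nonneg_left (wallRate_sq_le_sharp hy) hy0.le
  have e : y * (y + 1 / y + 8748 / y ^ 2) = y * y + 1 + 8748 / y := by
    field_simp
  nlinarith

/-- The coarse form `β(y)² ≤ y + 8749/y` (`y ≥ 1`), the shape used by `HexSAWSurfaceHookRenewal.sq_wallRate_ge_sub`.
[cite: BeatonBousquetMelouDeGierDuminilCopinGuttmann2014, §3.1 (arXiv v5 p. 10 remark)] -/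
theorem wallRate_sq_le_add_div (hy : 1 ≤ y) : wallRate y ^ 2 ≤ y + 8749 / y := by
  have hy0 : 0 < y := by linarith
  have h := wallRate_sq_le_sharp hy
  have h2 : 8748 / y ^ 2 ≤ 8748 / y := by
    apply div_le_div_of_nonneg_left (by norm_num) hy0
    nlinarith
  have e : (8749 : ℝ) / y = 1 / y + 8748 / y := by rw [← add_div]; norm_num
  linarith

/-! ### §8  The hook constant is ONE: the only one-visit wall bridge of length six is the forward dip -/

/-- **Anatomy of a one-visit wall bridge of length six**: it is the forward dip `(0,0) (1,0) (1,−1) (2,−1) (3,−1) (3,0) (4,0)` (the length is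
kept symbolic, `m = 6`, to spare the elaborator the closed `Finset` `wbr 6`). [cite: EntingJensen2009, §7.4.2, Fig. 7.10 (brickwork form of the honeycomb lattice); JansevanRensburg2000, §3.3.2, Lemma 3.20 (excursions)] -/
theorem one_visit_six_coords {m : ℕ} (hm : m = 6) (hω : ω ∈ wbr m) (hv : visits m ω = 1) :
    (ω 1 0 = 1 ∧ ω 1 1 = 0) ∧ (ω 2 0 = 1 ∧ ω 2 1 = -1) ∧ (ω 3 0 = 2 ∧ ω 3 1 = -1) ∧
      (ω 4 0 = 3 ∧ ω 4 1 = -1) ∧ (ω 5 0 = 3 ∧ ω 5 1 = 0) ∧ (ω 6 0 = 4 ∧ ω 6 1 = 0) := by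
  obtain ⟨hωa, hwb⟩ := mem_wbr.1 hω
  obtain ⟨hωh, -, hend⟩ := mem_archs.1 hωa
  obtain ⟨hωs, hH⟩ := mem_hpw.1 hωh
  obtain ⟨h0, -, hbw, hinj⟩ := mem_saws_iff.1 hωs
  have hend6 : ω 6 1 = 0 := by have h := hend; rwa [hm] at h
  have hne : ∀ a b : ℕ, a ≤ 6 → b ≤ 6 → a ≠ b → ¬ (ω a 0 = ω b 0 ∧ ω a 1 = ω b 1) := by
    intro a b ha hb hab h
    have := hinj (show a ∈ {i | i ≤ m} by simp only [Set.mem_setOf_eq]; omega)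
      (show b ∈ {i | i ≤ m} by simp only [Set.mem_setOf_eq]; omega) ((site_two_eq_iff _ _).2 h)
    exact hab this
  have h00 : ω 0 0 = 0 := by rw [h0]; rfl
  have h01 : ω 0 1 = 0 := by rw [h0]; rfl
  -- one visit: times 2 and 4 are off the row
  have hv6 : visits 6 ω = 1 := by have h := hv; rwa [hm] at h
  have hv' : (if ω 2 1 = 0 then 1 else 0) + (if ω 4 1 = 0 then 1 else 0) + (if ω 6 1 = 0 then 1 else 0) = 1 := by
    have e : visits 6 ω = (if ω 2 1 = 0 then 1 else 0) + (if ω 4 1 = 0 then 1 else 0) + (if ω 6 1 = 0 then 1 else 0) := by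
      simp [visits]
    rw [← e, hv6]
  rw [if_pos hend6] at hv'
  have hn24 : ¬ (ω 2 1 = 0) ∧ ¬ (ω 4 1 = 0) := by
    by_cases h2 : ω 2 1 = 0 <;> by_cases h4 : ω 4 1 = 0 <;> simp only [h2, h4, if_true, if_false] at hv' <;>
      first | exact ⟨h2, h4⟩ | (exfalso; omega)
  obtain ⟨hn2, hn4⟩ := hn24
  -- the steps
  obtain ⟨hY1, hX1⟩ := surface_next_step hωh (i := 0) (by omega) (by omega) h01
  rw [show 0 + 1 = 1 from rfl] at hY1 hX1
  have hwb1 := (hwb 1 (by omega)).1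
  have s2 := Arm.step_cases (hbw 1 (by omega))
  rw [show 1 + 1 = 2 from rfl] at s2
  have s3 := Arm.step_cases (hbw 2 (by omega))
  rw [show 2 + 1 = 3 from rfl] at s3
  have s4 := Arm.step_cases (hbw 3 (by omega))
  rw [show 3 + 1 = 4 from rfl] at s4
  have s5 := Arm.step_cases (hbw 4 (by omega))
  rw [show 4 + 1 = 5 from rfl] at s5
  have s6 := Arm.step_cases (hbw 5 (by omega))
  rw [show 5 + 1 = 6 from rfl] at s6
  have hH2 := hH 2 (by omega)
  have hH4 := hH 4 (by omega)
  -- (no hypothesis with a CLOSED index such as `ω ∈ archs 6` is ever introduced: the linter would `whnf` it into an enumeration)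
  obtain ⟨hY5, hX6⟩ : ω 5 1 = 0 ∧ (ω (5 + 1) 0 = ω 5 0 + 1 ∨ ω 5 0 = ω (5 + 1) 0 + 1) :=
    arch_last_step (n := 5) (by rw [show 5 + 1 = m by omega]; exact hωa)
  rw [show 5 + 1 = 6 from rfl] at hX6
  have h31 := hne 3 1 (by omega) (by omega) (by omega)
  have h42 := hne 4 2 (by omega) (by omega) (by omega)
  have hwb3 := (hwb 3 (by omega)).1
  have hwb4 := (hwb 4 (by omega)).1
  have hwb5 := hwb 5 (by omega)
  rw [hm] at hwb5
  -- (each `omega` sees only the disjunctions it needs)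
  have hX1' : ω 1 0 = 1 := by clear s2 s3 s4 s5 s6 hX6 h31 h42; omega
  have hX2 : ω 2 0 = 1 ∧ ω 2 1 = -1 := by clear s3 s4 s5 s6 hX6 h31 h42; constructor <;> omega
  obtain ⟨hX2a, hX2b⟩ := hX2
  have h3 : ω 3 1 = -1 ∧ (ω 3 0 = 0 ∨ ω 3 0 = 2) := by clear s2 s4 s5 s6 hX6 h42 hX1; constructor <;> omega
  obtain ⟨hY3, hX3⟩ := h3
  have hY4 : ω 4 1 = -1 := by clear s2 s3 s6 hX6 hX1 h31 h42; omega
  have hX4 : ω 4 0 = ω 3 0 + 1 ∨ ω 3 0 = ω 4 0 + 1 := by clear s2 s3 s5 s6 hX6 hX1 h31 h42; omega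
  have hX3' : ω 3 0 = 2 := by clear s2 s3 s4 s5 s6 hX6 hX1 h31; omega
  have hX4' : ω 4 0 = 3 := by clear s2 s3 s4 s5 s6 hX6 hX1 h31; omega
  have hX5 : ω 5 0 = 3 := by clear s2 s3 s4 s6 hX6 hX1 h31 h42 hX4; omega
  have hX6' : ω 6 0 = 4 := by clear s2 s3 s4 s5 h31 h42 hX4; omega
  exact ⟨⟨hX1', hY1⟩, ⟨hX2a, hX2b⟩, ⟨hX3', hY3⟩, ⟨hX4', hY4⟩, ⟨hX5, hY5⟩, ⟨hX6', hend6⟩⟩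

open Classical in
/-- **At most one one-visit wall bridge of length `m = 6`** (symbolic length). [cite: JansevanRensburg2000, §3.3.2, Lemma 3.20; EntingJensen2009, §7.4.2, Fig. 7.10] -/
theorem card_oneVisit_le_one {m : ℕ} (hm : m = 6) : #((wbr m).filter fun ω => visits m ω = 1) ≤ 1 := by
  refine Finset.card_le_one.2 fun ω hω ω' hω' => ?_
  obtain ⟨hωw, hv⟩ := Finset.mem_filter.1 hω
  obtain ⟨hωw', hv'⟩ := Finset.mem_filter.1 hω'
  have hc := one_visit_six_coords hm hωw hv
  have hc' := one_visit_six_coords hm hωw' hv'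
  have hωs : ω ∈ saws m := hpw_subset (archs_subset (wbr_subset hωw))
  have hωs' : ω' ∈ saws m := hpw_subset (archs_subset (wbr_subset hωw'))
  obtain ⟨h0, -, -, -⟩ := mem_saws_iff.1 hωs
  obtain ⟨h0', -, -, -⟩ := mem_saws_iff.1 hωs'
  obtain ⟨⟨a0, a1⟩, ⟨b0, b1⟩, ⟨c0, c1⟩, ⟨d0, d1⟩, ⟨e0, e1⟩, ⟨f0, f1⟩⟩ := hc
  obtain ⟨⟨a0', a1'⟩, ⟨b0', b1'⟩, ⟨c0', c1'⟩, ⟨d0', d1'⟩, ⟨e0', e1'⟩, ⟨f0', f1'⟩⟩ := hc'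
  refine Arm.eq_of_agree hωs hωs' fun i hi => ?_
  have hcase : i = 0 ∨ i = 1 ∨ i = 2 ∨ i = 3 ∨ i = 4 ∨ i = 5 ∨ i = 6 := by omega
  rcases hcase with rfl | rfl | rfl | rfl | rfl | rfl | rfl
  · rw [h0, h0']
  · exact (site_two_eq_iff _ _).2 ⟨by rw [a0, a0'], by rw [a1, a1']⟩
  · exact (site_two_eq_iff _ _).2 ⟨by rw [b0, b0'], by rw [b1, b1']⟩
  · exact (site_two_eq_iff _ _).2 ⟨by rw [c0, c0'], by rw [c1, c1']⟩
  · exact (site_two_eq_iff _ _).2 ⟨by rw [d0, d0'], by rw [d1, d1']⟩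
  · exact (site_two_eq_iff _ _).2 ⟨by rw [e0, e0'], by rw [e1, e1']⟩
  · exact (site_two_eq_iff _ _).2 ⟨by rw [f0, f0'], by rw [f1, f1']⟩

open Classical Six in
/-- **At least one**: the dip `Six.dw` of `HexSAWSurfaceSqrtStrict` is a one-visit wall bridge of length `m = 6` (symbolic length).
[cite: BeatonBousquetMelouDeGierDuminilCopinGuttmann2014, §3.1, Proposition 5 (arXiv v5 p. 9); JansevanRensburg2000, §3.3.2, Lemma 3.20] -/
theorem one_le_card_oneVisit {m : ℕ} (hm : m = 6) : 1 ≤ #((wbr m).filter fun ω => visits m ω = 1) := by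
  obtain ⟨h0, hfr, hbw, hinj, hH, harch, hwb⟩ := dw_components
  have h1 : dw ∈ wbr m := by
    rw [mem_wbr, mem_archs, mem_hpw, mem_saws_iff]
    subst hm
    exact ⟨⟨⟨⟨h0, hfr, hbw, hinj⟩, hH⟩, harch⟩, hwb⟩
  have h2 : visits m dw = 1 := by rw [hm]; exact visits_sw_dw.2
  have hmem : dw ∈ (wbr m).filter (fun ω => visits m ω = 1) := Finset.mem_filter.2 ⟨h1, h2⟩
  exact Finset.card_pos.2 ⟨_, hmem⟩

/-- ★★ **THE HOOK CONSTANT IS ONE: `wbrN 6 1 = 1`**, hence `hookConst = 1` — the renewal coefficient `h` of `HexSAWSurfaceHookRenewal`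
(where `1 ≤ h` entered by hypothesis and its value was not of record). [cite: JansevanRensburg2000, §3.3.2, Lemma 3.20; EntingJensen2009, §7.4.2, Fig. 7.10] -/
theorem wbrN_six_one : wbrN 6 1 = 1 :=
  le_antisymm (card_oneVisit_le_one rfl) (one_le_card_oneVisit rfl)

/-- `hookConst = 1`. [cite: JansevanRensburg2000, §3.3.2, Lemma 3.20] -/
theorem hookConst_eq_one : hookConst = 1 := by
  rw [hookConst_eq, wbrN_six_one, Nat.cast_one]

/-! ### §9  THE SECOND-ORDER LAW: `β(y)² = y + 1/y + O(y⁻²)`, `y (β(y)² − y) → 1`, `y^{3/2} (β(y) − √y) → ½`, `y² (log β(y) − ½ log y) → ½` -/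

/-- ★★ **The sharp LOWER window made unconditional**: `y + 1/y − 26247/y³ ≤ β(y)²` for every `y ≥ 1` — `HexSAWSurfaceHookRenewal`'s
`sq_wallRate_ge_sub` (lower coefficient `h = hookConst`) fed with §7's upper window (`C = 8749`) and §8's `hookConst = 1`.
[cite: JansevanRensburg2000, §3.3.2, Lemma 3.20; HammersleyTorrieWhittington1982, §2; BeatonBousquetMelouDeGierDuminilCopinGuttmann2014, §3.1, Proposition 5 (arXiv v5 p. 9)] -/
theorem sharp_lower_window (hy : 1 ≤ y) : y + 1 / y - 26247 / y ^ 3 ≤ wallRate y ^ 2 := by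
  have hy0 : 0 < y := by linarith
  have h := sq_wallRate_ge_sub hy0 (C := 8749) (by norm_num) (wallRate_sq_le_add_div hy)
  rw [hookConst_eq_one] at h
  have e : (3 : ℝ) * 1 * 8749 / y ^ 3 = 26247 / y ^ 3 := by norm_num
  rw [one_div] at h ⊢
  linarith

/-- ★★★ **THE TWO-SIDED SECOND-ORDER WINDOW**: `β(y)² − y − 1/y ∈ [−26247/y³, 8748/y²]` for every `y ≥ 1` — the adsorbed-phase free
energy per two steps of honeycomb SAW at the Duminil-Copin–Smirnov surface is `log y + 1/y² + O(y⁻³)`; the coefficient ONE counts the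
single cheapest defect, the dip around one hexagon. [cite: BeatonBousquetMelouDeGierDuminilCopinGuttmann2014, §3.1 (arXiv v5 p. 10: "This translates into μ(y) ∼ √y in our honeycomb setting"); RychlewskiWhittington2011, Theorem (square-lattice analogue; not held); JansevanRensburg2000, §3.3.2, Lemma 3.20] -/
theorem wallRate_sq_sub_sub_mem_Icc (hy : 1 ≤ y) :
    wallRate y ^ 2 - y - 1 / y ∈ Set.Icc (-(26247 / y ^ 3)) (8748 / y ^ 2) := by
  constructor
  · have := sharp_lower_window hy; linarith
  · exact wallRate_sq_sub_sub_le hy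

/-- ★★★ **`|y · (β(y)² − y) − 1| ≤ 34995/y`** for every `y ≥ 1`. [cite: BeatonBousquetMelouDeGierDuminilCopinGuttmann2014, §3.1 (arXiv v5 p. 10 remark); JansevanRensburg2000, §3.3.2, Lemma 3.20] -/
theorem abs_mul_wallRate_sq_sub_sub_one_le (hy : 1 ≤ y) : |y * (wallRate y ^ 2 - y) - 1| ≤ 34995 / y := by
  have hy0 : 0 < y := by linarith
  obtain ⟨h1, h2⟩ := wallRate_sq_sub_sub_mem_Icc hy
  have e : y * (wallRate y ^ 2 - y) - 1 = y * (wallRate y ^ 2 - y - 1 / y) := by field_simp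
  rw [e, abs_le]
  constructor
  · have h3 : y * (-(26247 / y ^ 3)) ≤ y * (wallRate y ^ 2 - y - 1 / y) := mul_le_mul_of_nonneg_left h1 hy0.le
    have e3 : y * (-(26247 / y ^ 3)) = -(26247 / y ^ 2) := by field_simp
    have h4 : (26247 : ℝ) / y ^ 2 ≤ 34995 / y := by
      rw [div_le_div_iff₀ (by positivity) hy0]; nlinarith
    linarith
  · have h3 : y * (wallRate y ^ 2 - y - 1 / y) ≤ y * (8748 / y ^ 2) := mul_le_mul_of_nonneg_left h2 hy0.le
    have e3 : y * (8748 / y ^ 2) = 8748 / y := by field_simp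
    have h4 : (8748 : ℝ) / y ≤ 34995 / y := by gcongr; norm_num
    linarith

/-- ★★★ **`y · (β(y)² − y) → 1` as `y → ∞`: the second-order coefficient of the adsorbed-phase free energy is EXACTLY ONE.**
[cite: BeatonBousquetMelouDeGierDuminilCopinGuttmann2014, §3.1 (arXiv v5 p. 10: "This translates into μ(y) ∼ √y in our honeycomb setting" — the first-order law, stated without proof); RychlewskiWhittington2011, Theorem (square-lattice first-order analogue; not held); JansevanRensburg2000, §3.3.2, Lemma 3.20] -/
theorem tendsto_mul_wallRate_sq_sub : Tendsto (fun y : ℝ => y * (wallRate y ^ 2 - y)) atTop (𝓝 1) := by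
  have hb : Tendsto (fun y : ℝ => (34995 : ℝ) / y) atTop (𝓝 0) := tendsto_const_nhds.div_atTop tendsto_id
  have h0 : Tendsto (fun y : ℝ => y * (wallRate y ^ 2 - y) - 1) atTop (𝓝 0) := by
    refine squeeze_zero_norm' ?_ hb
    filter_upwards [eventually_ge_atTop (1 : ℝ)] with y hy
    rw [Real.norm_eq_abs]
    exact abs_mul_wallRate_sq_sub_sub_one_le hy
  have h1 := h0.add_const 1
  simp only [zero_add, sub_add_cancel] at h1
  exact h1

/-- ★★ **`β(y)² − y − 1/y = O(y⁻²)`.** [cite: BeatonBousquetMelouDeGierDuminilCopinGuttmann2014, §3.1 (arXiv v5 p. 10 remark); JansevanRensburg2000, §3.3.2, Lemma 3.20] -/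
theorem isBigO_wallRate_sq_sub_sub :
    (fun y : ℝ => wallRate y ^ 2 - y - 1 / y) =O[atTop] (fun y : ℝ => (y ^ 2)⁻¹) := by
  refine Asymptotics.IsBigO.of_bound 26247 ?_
  filter_upwards [eventually_ge_atTop (1 : ℝ)] with y hy
  have hy0 : 0 < y := by linarith
  obtain ⟨h1, h2⟩ := wallRate_sq_sub_sub_mem_Icc hy
  rw [Real.norm_eq_abs, Real.norm_of_nonneg (inv_nonneg.2 (by positivity)), abs_le]
  have h3 : (26247 : ℝ) / y ^ 3 ≤ 26247 * (y ^ 2)⁻¹ := by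
    rw [← div_eq_mul_inv, div_le_div_iff₀ (by positivity) (by positivity)]; nlinarith
  have h4 : (8748 : ℝ) / y ^ 2 ≤ 26247 * (y ^ 2)⁻¹ := by
    rw [← div_eq_mul_inv]; gcongr; norm_num
  constructor <;> linarith

/-- ★★ **`y^{3/2} · (β(y) − √y) → ½`**: `β(y) = √y + 1/(2 y^{3/2}) + o(y^{-3/2})` (from `y (β² − y) → 1` and `β/√y → 1`:
`y √y (β − √y) = y (β² − y) · √y/(β + √y)`). [cite: BeatonBousquetMelouDeGierDuminilCopinGuttmann2014, §3.1 (arXiv v5 p. 10: "μ(y) ∼ √y"); JansevanRensburg2000, §3.3.2, Lemma 3.20] -/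
theorem tendsto_mul_sqrt_mul_wallRate_sub_sqrt :
    Tendsto (fun y : ℝ => y * Real.sqrt y * (wallRate y - Real.sqrt y)) atTop (𝓝 (1 / 2)) := by
  have hq : Tendsto (fun y : ℝ => Real.sqrt y / (wallRate y + Real.sqrt y)) atTop (𝓝 (1 / 2)) := by
    have h1 : Tendsto (fun y : ℝ => wallRate y / Real.sqrt y + 1) atTop (𝓝 (1 + 1)) := tendsto_wallRate_div_sqrt.add_const 1
    have h2 := h1.inv₀ (by norm_num)
    rw [show ((1 : ℝ) + 1)⁻¹ = 1 / 2 by norm_num] at h2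
    refine h2.congr' ?_
    filter_upwards [eventually_gt_atTop (0 : ℝ)] with y hy
    have hs : 0 < Real.sqrt y := Real.sqrt_pos.2 hy
    have hβ := wallRate_pos y
    field_simp
  have h := tendsto_mul_wallRate_sq_sub.mul hq
  rw [one_mul] at h
  refine h.congr' ?_
  filter_upwards [eventually_gt_atTop (0 : ℝ)] with y hy
  have hs : 0 < Real.sqrt y := Real.sqrt_pos.2 hy
  have hβ := wallRate_pos y
  have hsq : Real.sqrt y ^ 2 = y := Real.sq_sqrt hy.le
  have hne : wallRate y + Real.sqrt y ≠ 0 := by positivity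
  field_simp
  nlinarith [hsq]

/-- ★★ **The surface free energy: `y² · (log β(y) − ½ log y) → ½`**, i.e. `κ(y) = log β(y) = ½ log y + 1/(2y²) + o(y⁻²)` (from
`log t ∈ [1 − 1/t, t − 1]` at `t = β²/y = 1 + (β² − y)/y`). [cite: BeatonBousquetMelouDeGierDuminilCopinGuttmann2014, §3.1, Proposition 5 (arXiv v5 p. 9) and p. 10 remark; JansevanRensburg2000, §3.3.2, Lemma 3.20] -/
theorem tendsto_sq_mul_log_wallRate_sub :
    Tendsto (fun y : ℝ => y ^ 2 * (Real.log (wallRate y) - Real.log y / 2)) atTop (𝓝 (1 / 2)) := by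
  -- `u(y) = (β² − y)/y`, `y² u → 1`
  have hu : Tendsto (fun y : ℝ => y ^ 2 * ((wallRate y ^ 2 - y) / y)) atTop (𝓝 1) := by
    refine tendsto_mul_wallRate_sq_sub.congr' ?_
    filter_upwards [eventually_gt_atTop (0 : ℝ)] with y hy
    field_simp
  -- `t = β²/y → 1`
  have ht : Tendsto (fun y : ℝ => wallRate y ^ 2 / y) atTop (𝓝 1) := by
    have h := tendsto_wallRate_div_sqrt.pow 2
    rw [one_pow] at h
    refine h.congr' ?_
    filter_upwards [eventually_gt_atTop (0 : ℝ)] with y hy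
    rw [div_pow, Real.sq_sqrt hy.le]
  -- upper: `y² log t ≤ y² (t − 1) = y² u`; lower: `y² log t ≥ y² (1 − 1/t) = y² u / t`
  have hlow : Tendsto (fun y : ℝ => y ^ 2 * ((wallRate y ^ 2 - y) / y) / (wallRate y ^ 2 / y)) atTop (𝓝 1) := by
    have h := hu.div ht one_ne_zero
    rw [div_one] at h
    exact h
  have hlog2 : Tendsto (fun y : ℝ => y ^ 2 * Real.log (wallRate y ^ 2 / y)) atTop (𝓝 1) := by
    refine tendsto_of_tendsto_of_tendsto_of_le_of_le' hlow hu ?_ ?_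
    · filter_upwards [eventually_gt_atTop (0 : ℝ)] with y hy
      have hβ := wallRate_pos y
      have ht0 : 0 < wallRate y ^ 2 / y := by positivity
      have h1 : 1 - (wallRate y ^ 2 / y)⁻¹ ≤ Real.log (wallRate y ^ 2 / y) := Real.one_sub_inv_le_log_of_pos ht0
      have e : y ^ 2 * ((wallRate y ^ 2 - y) / y) / (wallRate y ^ 2 / y) = y ^ 2 * (1 - (wallRate y ^ 2 / y)⁻¹) := by
        field_simp
      rw [e]
      exact mul_le_mul_of_nonneg_left h1 (by positivity)
    · filter_upwards [eventually_gt_atTop (0 : ℝ)] with y hy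
      have hβ := wallRate_pos y
      have ht0 : 0 < wallRate y ^ 2 / y := by positivity
      have h1 : Real.log (wallRate y ^ 2 / y) ≤ wallRate y ^ 2 / y - 1 := Real.log_le_sub_one_of_pos ht0
      have e : (wallRate y ^ 2 - y) / y = wallRate y ^ 2 / y - 1 := by field_simp
      rw [e]
      exact mul_le_mul_of_nonneg_left h1 (by positivity)
  have h := hlog2.mul_const (1 / 2)
  rw [one_mul] at h
  refine h.congr' ?_
  filter_upwards [eventually_gt_atTop (0 : ℝ)] with y hy
  have hβ := wallRate_pos y
  rw [Real.log_div (pow_ne_zero 2 hβ.ne') hy.ne', Real.log_pow]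
  push_cast
  ring

end Literature.Probability.RandomPlanarGeometry.SAW.HexBW.Wall
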